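import Summits.HodgeConjecture.HodgeConjecture.Theorems.LinearSystemTorelliMiddleDivisorSupportFourfoldOfDominantQbarEnvelope
import Summits.HodgeConjecture.HodgeConjecture.Theorems.LimitExtensionDivisorInduction
import Literature.AlgebraicGeometry.HodgeTheory.AlgebraicCyclesDefinedOverQbarProofs
import Literature.AlgebraicGeometry.HodgeTheory.LefschetzOneOneHolds
import HarnessLib

/-!
# Route `LinearSystemTorelli` — crux `MiddleDivisorSupportFourfold` (stmt-HodgeConjecture-2409):
# the E-side of line `IdeatorFiveSketch` is NECESSARY in dimension 4 (unconditional tightness)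

Helper file for the crux item stmt-HodgeConjecture-2409 (`--supports`; it closes nothing), line
`IdeatorFiveSketch` (idea `weakly-nonfactor-descent`), lead c15.

The registered sector stub E `stub_qbarDivisorSupportCodimTwo` asks, for every `σ : ℚ̄ →+* ℂ`, every
`ℚ̄`-scheme `W₀` with smooth projective complexification `W₀ ⊗_σ ℂ` of ANY dimension `m` and every
rational `(2,2)`-class `c'` on it, for a proper Zariski-closed `Z₀ ⊊ W₀` off whose preimage `c'`
dies; lead c11 showed E ⟺ HC/`ℚ̄`(·,2) exactly (p130143), and the composition consumes E at
`m = 4 + dim S₀` (`S₀` the base of a `ℚ̄`-spread of the fourfold).  This file records, sorry-free and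
UNCONDITIONALLY, that the `m = 4` slice of E is implied by the crux itself:

* `linearSystemTorelli_hodgeConjectureCodimTwo_of_middleDivisorSupportFourfold` — crux ⟹ HC(4,2): a divisor-supported
  rational `(2,2)`-class on a fourfold is algebraic, by the route's PROVED `DivisorInduction`
  (stmt-1082, `linearSystemTorelli_divisorInduction_proof`, at `n = 3`, `p = 2`) fed with Lefschetz
  `(1,1)` on threefolds (`lefschetzOneOne_rational_holds`, PROVED);
* `linearSystemTorelli_qbarDivisorSupportCodimTwo_four_of_middleDivisorSupportFourfold` — crux ⟹
  E at `m = 4`: on `W₀ ⊗_σ ℂ` a fourfold, `c'` is algebraic by the previous theorem, hence dies off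
  the preimage of a Zariski-closed `Z₀ ⊆ W₀` of codimension `≥ 2` by the DISCHARGED Charles–Schnell
  fact `charlesSchnell2014_algebraicClasses_supportedOn_qbarClosed_holds`, and `Z₀ ≠ W₀` because `W₀`
  is irreducible with generic point of codimension `0`
  (`linearSystemTorelli_ne_univ_of_forall_le_coheight_of_irreducibleSpace`).

So the E-side excess of the line over the crux is exactly the slices `m ≥ 5` of HC/`ℚ̄`(·,2) (needed
because the dominant `ℚ̄`-envelope of a transcendental fourfold is the compactified total space of its
spread, of dimension `4 + dim S₀`), while `m ≤ 3` is proved (p121589) and `m = 4` is necessary (here).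
No definitions, no named facts.
-/

-- every declaration of this problem lives in `Summit.HodgeConjecture.HodgeConjecture.…`
set_option linter.dupNamespace false

noncomputable section

namespace Summit.HodgeConjecture.HodgeConjecture.Theorems

open CategoryTheory AlgebraicGeometry
open Summit.HodgeConjecture.HodgeConjecture.Theses
open Literature.AlgebraicGeometry Literature.AlgebraicGeometry.Motives
open Literature.AlgebraicGeometry.HodgeTheory

/-- **Crux ⟹ HC(4,2), unconditionally.**  If every rational `(2,2)`-class on every smooth projective
complex fourfold is supported on a divisor (`MiddleDivisorSupportFourfold`), then every such class is
algebraic: the route's `DivisorInduction` (stmt-HodgeConjecture-1082, PROVED as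
`linearSystemTorelli_divisorInduction_proof`) at `n = 3`, `p = 2` turns divisor support into
algebraicity granted the Hodge conjecture in codimension `p - 1 = 1` on threefolds, which is Lefschetz
`(1,1)` (`lefschetzOneOne_rational_holds`, PROVED).  This is the UNCONDITIONAL form of
`linearSystemTorelli_hc42_of_middleDivisorSupportFourfold` (`…CodimTwoIff.lean`, p108510), which took
Deligne 1974 (8.2.8), the Hodge-class Gysin lift and Lefschetz `(1,1)` as named-fact hypotheses.
[cite: Thomas2005Nodes, Thm. 1] [cite: VoisinHodgeI2002, Thm. 11.30 (Lefschetz theorem on (1,1)-classes)] -/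
theorem linearSystemTorelli_hodgeConjectureCodimTwo_of_middleDivisorSupportFourfold : LinearSystemTorelli.MiddleDivisorSupportFourfold → ∀ ⦃X : SchemeOver ℂ⦄, IsSmoothProjective 4 X → ∀ c : complexBetti X 4, IsRationalClass c → IsOfHodgeType 4 X 4 2 2 c → c ∈ algebraicClasses X 2 :=
  fun h _ hX c hc hh ↦ linearSystemTorelli_divisorInduction_proof 3 2 (by norm_num)
    (fun _ hY c hc hh ↦ lefschetzOneOne_rational_holds hY c hc hh) hX c hc hh (h hX c hc hh)

/-- **Crux ⟹ the `m = 4` slice of stub E, unconditionally (tightness of the E-side in dimension 4).**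
If `MiddleDivisorSupportFourfold` holds then for every `σ : ℚ̄ →+* ℂ`, every `ℚ̄`-scheme `W₀` whose
complexification is a smooth projective FOURFOLD and every rational `(2,2)`-class `c'` on `W₀ ⊗_σ ℂ`
there is a proper Zariski-closed `Z₀ ⊊ W₀` off whose preimage `c'` dies: `c'` is algebraic
(`linearSystemTorelli_hodgeConjectureCodimTwo_of_middleDivisorSupportFourfold`), algebraic classes on `ℚ̄`-varieties die
off the preimage of a `ℚ̄`-closed subset of codimension `≥ 2` (Charles–Schnell, Cor. 11.3.16 and the
Remark following it; DISCHARGED in the tree as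
`charlesSchnell2014_algebraicClasses_supportedOn_qbarClosed_holds`), and such a subset is proper since
`W₀` is irreducible (`irreducibleSpace_of_irreducibleSpace_baseChangeHom_obj`) with generic point of
codimension `0`. [cite: CharlesSchnell2014Notes, Cor. 11.3.16 and the Remark following it] -/
theorem linearSystemTorelli_qbarDivisorSupportCodimTwo_four_of_middleDivisorSupportFourfold : LinearSystemTorelli.MiddleDivisorSupportFourfold → ∀ (σ : AlgebraicClosure ℚ →+* ℂ) (W₀ : SchemeOver (AlgebraicClosure ℚ)), IsSmoothProjective 4 ((baseChangeHom σ).obj W₀) → ∀ (c' : complexBetti ((baseChangeHom σ).obj W₀) 4), IsRationalClass c' → IsOfHodgeType 4 ((baseChangeHom σ).obj W₀) 4 2 2 c' → ∃ Z₀ : Set W₀.left, IsClosed Z₀ ∧ Z₀ ≠ Set.univ ∧ complexBetti.restrictCompl ((baseChangeHom σ).obj W₀) ((baseChangeHomFst σ W₀).base ⁻¹' Z₀) 4 c' = 0 := by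
  intro h σ W₀ hW c' hc' hh'
  obtain ⟨Z₀, hZ₀, hcoh, hd⟩ := charlesSchnell2014_algebraicClasses_supportedOn_qbarClosed_holds σ W₀
    hW 2 c' (linearSystemTorelli_hodgeConjectureCodimTwo_of_middleDivisorSupportFourfold h hW c' hc' hh')
  haveI := irreducibleSpace_of_isSmoothProjective' hW
  haveI := irreducibleSpace_of_irreducibleSpace_baseChangeHom_obj σ W₀
  exact ⟨Z₀, hZ₀,
    linearSystemTorelli_ne_univ_of_forall_le_coheight_of_irreducibleSpace (by norm_num) hcoh, hd⟩

end Summit.HodgeConjecture.HodgeConjecture.Theorems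

end
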